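import Mathlib
import HarnessLib
import Summits.Parity.GeneralizedHardyLittlewood.Theses.LeeYangFibres

/-!
# Route `LeeYangFibres`, crux `AbsoluteUpgrade` (stmt-Parity-14116): vocabulary of the line `nlc-cells-absolute-clip`

Route-posited objects and STATEMENTS (D-0016 `<Route><Crux>Defs` file) shared by the registered stubs of the
skeleton `Cruxes/AbsoluteUpgrade/Lines/nlc_cells_absolute_clip.lean` (crux-plan `nlc-cells-absolute-clip`, picked by
the line lead `prover-line-stmt-Parity-14116-1`, 2026-08-16) and by the files that prove and compose them.  Nothing is
asserted: every `def … : Prop` below is a statement (the TYPE of a registered stub, or of a hypothesis of one),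
consumed only as such; the one theorem, `cellParityLaw_of_log3`, is proved (the log₃-uniform cell parity law
restricts to the route's crux `CellParityLaw` verbatim).

The line (one paragraph).  Write the joint rough `Ω`-cells of a `d = 1` system as `C_j = Θ(σ(j)) M_j + E_j` (the
route's cell parity law, uniformly for `2 ≤ u ≤ A log log log N`: `CellParityLawLog3`).  The independent-anatomy
model `M_j` is a PRODUCT over the forms, hence extremal (slack `0`) for the negative lattice condition
`C_{j∨j'} C_{j∧j'} ≤ C_j C_{j'}`; corner NLC with an absolute, mass-scaled slack (`CellNLC`, the line's one
non-sieve input) clips the MIXED parity amplitudes to the law's own absolute accuracy (`WalshClipping`), the SINGLE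
amplitudes are sieve-visible with relative rate `e^{-cu}` (`SinglesDecay`), and the factor
`sup ∏_p β_p ≤ C(t,L)(log log N)^{t-1}` that defines the crux (tree: `stub_singularProduct_le_loglog_pow`) is paid
once, at slowly divergent roughness `u(N) ≍ log log log N`, giving the prime corner cell ABSOLUTELY
(`PrimeCellsAbsolute`) and then `DimOne` by partial summation.

Objects: `jointCell`, `roughTuples`, `roughCell`, `walshForm`, `modelCell`, `IsCorner` (all verbatim from the
route file's `CellParityLaw` / `FibreHyperbolicity` bodies).  Statements: `CellParityLawLog3`, `CellNLC` (the two
conjectural, `RelativeDimOne`-guarded inputs), `SinglesDecay`, `WalshClipping`, `RoughAnatomy`,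
`PrimeCellsAbsolute` (provable glue / the cell-level node shared with the sibling line `dip-margin-rate-exchange`).

References: Green–Tao 2010 §1 [GreenTao2010] (normalisations `β_∞`, `∏_p β_p`); Alladi 1982 [Alladi1982] and
Tenenbaum III.6 [Tenenbaum2015] (rough `Ω`-cells); Borcea–Brändén 2009 [BorceaBranden2009] (negative dependence /
real stability pedigree of `CellNLC`); Friedlander–Iwaniec, Opera de Cribro [FriedlanderIwaniecOpera2010]
(fundamental lemma behind `SinglesDecay`).
-/

noncomputable section

open scoped BigOperators Classical
open Finset Filter

namespace Summit.Parity.GeneralizedHardyLittlewood.Cruxes.AbsoluteUpgrade.NlcCellsAbsoluteClip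

open Literature.NumberTheory.Sieve
open Summit.Parity.GeneralizedHardyLittlewood.Theses.LeeYangFibres

/-! ## Objects (inlined exactly as in the route file `Theses/LeeYangFibres.lean`) -/

/-- The route's joint rough cell
`C_j(Ψ, K, N, u) = #{n ∈ K ∩ [-N,N] ∩ ℤ : N^{1/u} < P⁻(ψ_i(n)) and Ω(ψ_i(n)) = j_i for every i}`
(verbatim the count inside `LeeYangFibres.CellParityLaw` / `FibreHyperbolicity`). [folklore] -/
def jointCell {t : ℕ} (Ψ : Fin t → AffLinForm 1) (K : Set (Fin 1 → ℝ)) (N u : ℕ) (j : Fin t → ℕ) : ℕ :=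
  ((latticeBox 1 N).filter (fun n => realPoint n ∈ K ∧ ∀ i, (N : ℝ) ^ ((1 : ℝ) / u) <
      (Nat.minFac ((Ψ i).eval n).toNat : ℝ) ∧ ArithmeticFunction.cardFactors ((Ψ i).eval n).toNat = j i)).card

/-- The rough tuples: `n ∈ K ∩ [-N,N] ∩ ℤ` with EVERY `ψ_i(n)` `N^{1/u}`-rough (the support of the marginals;
`= ⋃_j` of the cells, and for `N^{1/u} > 2L` exactly the union over `j ∈ [1,u]^t`). [folklore] -/
def roughTuples {t : ℕ} (Ψ : Fin t → AffLinForm 1) (K : Set (Fin 1 → ℝ)) (N u : ℕ) : Finset (Fin 1 → ℤ) :=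
  (latticeBox 1 N).filter (fun n => realPoint n ∈ K ∧ ∀ i, (N : ℝ) ^ ((1 : ℝ) / u) <
      (Nat.minFac ((Ψ i).eval n).toNat : ℝ))

/-- The model cell count `A_m(N) = #{n ≤ N : P⁻(n) > N^{1/u}, Ω(n) = m}` (verbatim the route's). [folklore] -/
def roughCell (N u m : ℕ) : ℕ :=
  ((Finset.Icc 1 N).filter (fun n => (N : ℝ) ^ ((1 : ℝ) / u) < (Nat.minFac n : ℝ) ∧
      ArithmeticFunction.cardFactors n = m)).card

/-- The route's Walsh form `Θ_θ(j) = Σ_{S ⊆ [t]} θ_S ∏_{i ∈ S} (-1)^{j_i + 1}` (parity-vector amplitude at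
the cell index `j`; `σ(m) = (-1)^{m+1}`, so the prime corner `j = 𝟙` has all signs `+1` and
`Θ_θ(𝟙) = Σ_S θ_S`). [folklore] -/
def walshForm {t : ℕ} (θ : Finset (Fin t) → ℝ) (j : Fin t → ℕ) : ℝ :=
  ∑ S : Finset (Fin t), θ S * ∏ i ∈ S, (-1 : ℝ) ^ (j i + 1)

/-- The route's model main term `M_j = β_∞(Ψ,K) · ∏_p β_p(Ψ) · ∏_i A_{j_i}(N)/N`. [folklore] -/
def modelCell {t : ℕ} (Ψ : Fin t → AffLinForm 1) (K : Set (Fin 1 → ℝ)) (N u : ℕ) (j : Fin t → ℕ) : ℝ :=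
  archFactor Ψ K * singularProduct Ψ * ∏ i, ((roughCell N u (j i) : ℕ) : ℝ) / N

/-- The prime corner of the index lattice: `j ∈ {1,2,3}^t` (populated for `u ≥ 4`; it realises every
parity pattern in BOTH orientations of each coordinate, `(1,2) : + → -` and `(2,3) : - → +`). [folklore] -/
def IsCorner {t : ℕ} (j : Fin t → ℕ) : Prop :=
  ∀ i, 1 ≤ j i ∧ j i ≤ 3

/-! ## Statements (types of the registered stubs; nothing is asserted) -/

/-- **Crux 3 along slowly divergent roughness.** `LeeYangFibres.CellParityLaw` (stmt-Parity-14109) with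
the roughness allowed to grow: for every `A`, uniformly for `2 ≤ u ≤ A log log log N`, the cells obey
`C_j = Θ(σ(j)) M_j ± ε N / log^t N` for all `j ∈ [1,u]^t`, with `θ_∅ = 1`, `|θ_S| ≤ 2`.  At fixed `u` this
is crux 3 verbatim (`cellParityLaw_of_log3` below); the only extra content is uniformity of `N₀` in
`u ≤ A log₃ N` (`z = N^{1/u} ≥ exp((log N)^{1-o(1)})`, the same sieve regime).  Conjecture-grade statement
(EH/tuple-GEH derivation only); in the line it is the type of the GUARDED stub
`stub_cellParityLawLog3 : RelativeDimOne → CellParityLawLog3` (line statement, not a literature fact; sources: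
Bombieri 1976 asymptotic sieve, Friedlander–Iwaniec 1978). -/
def CellParityLawLog3 : Prop :=
  ∀ (t L : ℕ), 1 ≤ t → ∀ A : ℝ, ∀ ε : ℝ, 0 < ε → ∃ N₀ : ℕ, ∀ N : ℕ, N₀ ≤ N →
    ∀ u : ℕ, 2 ≤ u → (u : ℝ) ≤ A * Real.log (Real.log (Real.log N)) →
      ∀ Ψ : Fin t → AffLinForm 1, IsNondegenerateSystem Ψ → affLinSize Ψ N ≤ L →
        ∀ K : Set (Fin 1 → ℝ), Convex ℝ K → K ⊆ realBox 1 N →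
          ∃ θ : Finset (Fin t) → ℝ, θ ∅ = 1 ∧ (∀ S, |θ S| ≤ 2) ∧
            ∀ j : Fin t → ℕ, (∀ i, 1 ≤ j i ∧ j i ≤ u) →
              |(jointCell Ψ K N u j : ℝ) - walshForm θ j * modelCell Ψ K N u j| ≤ ε * N / Real.log N ^ t

/-- **CellNLC — the line's non-sieve input** (replaces the zero-locus hypothesis `FibreHyperbolicity`).
On every admissible pair `(Ψ, K)` carrying singular mass `β_∞ ∏_p β_p ≥ η₀ N` (the route's own mass
hypothesis, cf. crux 2), uniformly for `4 ≤ u ≤ A log log log N`, the joint rough `Ω`-cells are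
LOG-SUBMODULAR on the prime corner `{1,2,3}^t` of the index lattice up to an absolute, mass-scaled slack:
`C_{j ∨ j'} · C_{j ∧ j'} ≤ C_j · C_{j'} + η · (β_∞ ∏β_p / N) · (N / log^t N)²`.
The independent-anatomy model `M_j` is a product over the forms, hence NLC-EXTREMAL (slack `0`); with ONE
mass factor the normalised slack is `η N/(β_∞∏β_p)`, the same scale as the law's normalised accuracy, so
the hypothesis is DimOne-level.  In the Hardy–Littlewood world the corner defect has the wrong sign only
from scale mixing over `K`, size `S²·I I'/(log u·log N)² ≪` slack; a mixed parity ghost of EITHER sign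
violates a corner instance by a fixed amount, and the perfectly correlated ghost `4·𝟙[σ₁=σ₂=σ₃]` violates
`C₂₂₂C₁₁₁ ≤ C₂₂₁C₁₁₂` by `16` (why the FULL corner lattice is typed).  Pedigree: per-prime exclusion ⇒ the
Kubilius count polynomial `∏_p((1 − ν_p/p) + p⁻¹Σ_i z_i)` is real stable ⇒ Rayleigh/NLC (Brändén 2007;
Borcea–Brändén–Liggett 2009).  HL-strength, conjecture-grade; false at resonant shifts under Siegel zeros of
unbounded quality, where `RelativeDimOne` fails — hence in the line it is the type of the GUARDED stub
`stub_cellNLC : RelativeDimOne → CellNLC` (line statement, not a literature fact; pedigree Borcea–Brändén 2009). -/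
def CellNLC : Prop :=
  ∀ (t L : ℕ), 1 ≤ t → ∀ A : ℝ, ∀ η₀ : ℝ, 0 < η₀ → ∀ η : ℝ, 0 < η → ∃ N₀ : ℕ, ∀ N : ℕ, N₀ ≤ N →
    ∀ u : ℕ, 4 ≤ u → (u : ℝ) ≤ A * Real.log (Real.log (Real.log N)) →
      ∀ Ψ : Fin t → AffLinForm 1, IsNondegenerateSystem Ψ → affLinSize Ψ N ≤ L →
        ∀ K : Set (Fin 1 → ℝ), Convex ℝ K → K ⊆ realBox 1 N →
          η₀ * N ≤ archFactor Ψ K * singularProduct Ψ →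
            ∀ j j' : Fin t → ℕ, IsCorner j → IsCorner j' →
              (jointCell Ψ K N u (j ⊔ j') : ℝ) * jointCell Ψ K N u (j ⊓ j') ≤
                (jointCell Ψ K N u j : ℝ) * jointCell Ψ K N u j' +
                  η * (archFactor Ψ K * singularProduct Ψ / N) * ((N : ℝ) / Real.log N ^ t) ^ 2

/-- **SinglesDecay — the single-form parity marginals are sieve-visible, with an exponential rate in `u`.**
For `t` forms there is `c = c(t, L) > 0` such that, uniformly for `4 ≤ u ≤ A log log log N` and all
admissible `(Ψ, K)`, the parity of `Ω(ψ_i(n))` summed over the rough tuples is at most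
`C e^{-cu} · β_∞ ∏_p β_p · (u / log N)^t + N / log^{t+1} N` (the first term is `C e^{-cu}` times the
size `≍ β_∞ ∏β_p (e^{-γ} u/log N)^t` of the rough-tuple set).  Proof route (all engines PROVED in the tree):
split by the sign of `λ(ψ_i(n))` into two non-negative sifted sequences, sift `∏_k ψ_k(n)` by the primes
`< N^{1/u}` with the Fundamental Lemma (`SieveSequence.fundamental_lemma_uniform_holds`, dimension `t`,
level `D = N^{1/2-δ}`, `s = u(1/2-δ)`, error `e^{-s}`), remainders by Bombieri–Vinogradov for the
Liouville/Möbius function along the form `ψ_i` (`bombieriVinogradov_moebius`, `λ = μ ∗ 1_{□}`), and the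
two main terms cancel up to `∑_{n ∈ K} λ(ψ_i(n)) = O(N e^{-c√log N})`
(`SiegelWalfiszMoebius.liouville_progression`, modulus `a_i ≤ L`); `∏_{p<z} β_p ≤ 2 ∏_p β_p`
(`tendsto_singularProductPartial_holds`).  At `t = 1`, `Ψ = (n)`, `K = [-N,N]` it is the parity balance of
the `N^{1/u}`-rough integers `≤ N` with rate `e^{-cu}` (Alladi's `ℓ(u) → 0`, here effectively).  Line statement (type of the registered stub `stub_singlesDecay`);
source of the engine: Friedlander–Iwaniec, Opera de Cribro, Cor. 6.10. -/
def SinglesDecay : Prop :=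
  ∀ (t L : ℕ), 1 ≤ t → ∃ c : ℝ, 0 < c ∧ ∀ A : ℝ, ∃ C : ℝ, ∃ N₀ : ℕ, ∀ N : ℕ, N₀ ≤ N →
    ∀ u : ℕ, 4 ≤ u → (u : ℝ) ≤ A * Real.log (Real.log (Real.log N)) →
      ∀ Ψ : Fin t → AffLinForm 1, IsNondegenerateSystem Ψ → affLinSize Ψ N ≤ L →
        ∀ K : Set (Fin 1 → ℝ), Convex ℝ K → K ⊆ realBox 1 N → ∀ i : Fin t,
          |∑ n ∈ roughTuples Ψ K N u, (-1 : ℝ) ^ (ArithmeticFunction.cardFactors ((Ψ i).eval n).toNat)| ≤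
            C * Real.exp (-(c * u)) * (archFactor Ψ K * singularProduct Ψ) * ((u : ℝ) / Real.log N) ^ t +
              (N : ℝ) / Real.log N ^ (t + 1)

/-- **WalshClipping — the finite-dimensional clipping lemma on the corner `{1,2,3}^t`.**  For each `t`
there are `c₀ > 0` and `C` such that: if normalised non-negative cells `c_j` are `δ`-close to a Walsh form
`Θ_θ(σ(j))` on the corner (`θ_∅ = 1`, `|θ_S| ≤ 2`), satisfy the negative lattice condition there with
slack `η`, and the single amplitudes are `≤ τ`, with `δ + η + τ ≤ c₀`, then the prime-corner value is
pinned: `|Θ_θ(𝟙) − 1| ≤ C (δ + η + τ)` — LINEARLY in the slacks (this linearity is what makes the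
clipping absolute).  Proof (line lead, all `t`, explicit `c₀ = 1`, `C = C(t)`): the corner instances with a
single swapped coordinate `i` between the patterns `(D, +_i)` and `(E, −_i)` give
`Θ(D,+)Θ(E,−) = Θ(D,−)Θ(E,+) ± η'` (`η' = η + O_t(δ)`); summing over `E ⊆ [t]∖{i}` and using the marginal
sums `Σ_E Θ(E, ±_i) = 2^{t−1}(1 ± θ_{{i}})` gives `|Θ(D,+) − Θ(D,−)| ≤ η' + 2^{t+2}τ`, and Walsh inversion in
the remaining `t − 1` coordinates bounds every `θ_S`, `S ∋ i`, by `(η' + 2^{t+2}τ)/2`; summing over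
`S ≠ ∅` pins `Θ(𝟙) = Σ_S θ_S`.  (`t = 2`: the two instances `(2,1)∨(1,2)`, `(3,1)∨(2,2)` read
`±4σσ'(θ₁₂ − θ₁θ₂) ≤ η + O(δ)`.)  Line statement (type of the registered stub `stub_walshClipping`). -/
def WalshClipping : Prop :=
  ∀ t : ℕ, ∃ c₀ : ℝ, 0 < c₀ ∧ ∃ C : ℝ, ∀ (θ : Finset (Fin t) → ℝ) (c : (Fin t → ℕ) → ℝ) (δ η τ : ℝ),
    0 ≤ δ → 0 ≤ η → 0 ≤ τ → δ + η + τ ≤ c₀ →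
    θ ∅ = 1 → (∀ S, |θ S| ≤ 2) → (∀ i : Fin t, |θ {i}| ≤ τ) →
    (∀ j, IsCorner j → 0 ≤ c j ∧ |c j - walshForm θ j| ≤ δ) →
    (∀ j j', IsCorner j → IsCorner j' → c (j ⊔ j') * c (j ⊓ j') ≤ c j * c j' + η) →
      |walshForm θ (fun _ => 1) - 1| ≤ C * (δ + η + τ)

/-- **RoughAnatomy — parity-free anatomy of rough integers, uniform along the slow range.**  For every
`A` there is `c > 0` with, for `N ≥ N₀` and `4 ≤ u ≤ A log log log N`: the corner model cells are of exact
order `N/log N` (`A_1 = π(N) − π(N^{1/u}) ≤ 2N/log N`; `A_2 ≥ #{pq ≤ N : N^{1/4} < p ≤ N^{1/3} < q}`,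
`A_3` likewise, `≫ N/log N` by Chebyshev + Mertens), and the rough integers number
`Φ(N, N^{1/u}) ≥ c u N/log N` (lower-bound Fundamental Lemma in dimension `1`, tree `roughCount_approx`
with `k = 1`, `W(z) = ∏_{p<z}(1 − 1/p) ≥ c'/log z = c' u/log N`; bounded `u` from the primes alone).
Line statement (type of the registered stub `stub_roughAnatomy`); source: Tenenbaum, III.6. -/
def RoughAnatomy : Prop :=
  ∀ A : ℝ, ∃ c : ℝ, 0 < c ∧ ∃ N₀ : ℕ, ∀ N : ℕ, N₀ ≤ N →
    ∀ u : ℕ, 4 ≤ u → (u : ℝ) ≤ A * Real.log (Real.log (Real.log N)) →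
      (∀ m ∈ ({1, 2, 3} : Finset ℕ), c * N / Real.log N ≤ (roughCell N u m : ℝ)) ∧
      (roughCell N u 1 : ℝ) ≤ 2 * N / Real.log N ∧
      c * u * N / Real.log N ≤ ∑ m ∈ Finset.Icc 1 u, (roughCell N u m : ℝ)

/-- **PrimeCellsAbsolute — the cell-level output of the line.**  At some roughness `u = u(N) ≥ 2` the prime
corner cell is its model `β_∞ ∏_p β_p (A_1(N)/N)^t` up to an ABSOLUTE error `ε N/log^t N`, uniformly over
admissible `(Ψ, K)` — the absolute counterpart of the route's `PrimeCellsRelative` (there: relative error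
`ε(M₁ + N/log^t N)` at a fixed `u`); the node shared with the sibling line `dip-margin-rate-exchange`.
Line statement (conclusion of `stub_clipCells`, hypothesis of `stub_cellsToDimOne`). -/
def PrimeCellsAbsolute : Prop :=
  ∀ (t L : ℕ), 1 ≤ t → ∀ ε : ℝ, 0 < ε → ∃ N₀ : ℕ, ∀ N : ℕ, N₀ ≤ N → ∃ u : ℕ, 2 ≤ u ∧
    ∀ Ψ : Fin t → AffLinForm 1, IsNondegenerateSystem Ψ → affLinSize Ψ N ≤ L →
      ∀ K : Set (Fin 1 → ℝ), Convex ℝ K → K ⊆ realBox 1 N →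
        |(jointCell Ψ K N u (fun _ => 1) : ℝ) - modelCell Ψ K N u (fun _ => 1)| ≤ ε * N / Real.log N ^ t

/-! ## Sanity (proved): the log₃-uniform law at fixed `u` is crux 3 verbatim -/

/-- `CellParityLawLog3` restricted to a fixed roughness `u` is the route's crux `CellParityLaw`
(stmt-Parity-14109): take `A = u` and wait until `log log log N ≥ 1`. [folklore] -/
theorem cellParityLaw_of_log3 : CellParityLawLog3 → CellParityLaw := by
  intro h t L u ht hu ε hε
  obtain ⟨N₀, hN₀⟩ := h t L ht u ε hε
  have h3 : Tendsto (fun N : ℕ => Real.log (Real.log (Real.log (N : ℝ)))) atTop atTop :=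
    Real.tendsto_log_atTop.comp (Real.tendsto_log_atTop.comp
      (Real.tendsto_log_atTop.comp tendsto_natCast_atTop_atTop))
  obtain ⟨N₁, hN₁⟩ := Filter.eventually_atTop.mp (h3.eventually_ge_atTop 1)
  refine ⟨max N₀ N₁, fun N hN Ψ hΨ hL K hK hKN => ?_⟩
  have hN0 : N₀ ≤ N := le_trans (le_max_left _ _) hN
  have hN1 : N₁ ≤ N := le_trans (le_max_right _ _) hN
  have hlog : (1 : ℝ) ≤ Real.log (Real.log (Real.log (N : ℝ))) := hN₁ N hN1
  have huA : (u : ℝ) ≤ (u : ℝ) * Real.log (Real.log (Real.log (N : ℝ))) :=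
    le_mul_of_one_le_right (Nat.cast_nonneg u) hlog
  obtain ⟨θ, hθ0, hθ2, hθ⟩ := hN₀ N hN0 u hu huA Ψ hΨ hL K hK hKN
  refine ⟨θ, hθ0, hθ2, fun j hj => ?_⟩
  simpa [jointCell, walshForm, modelCell, roughCell] using hθ j hj

end Summit.Parity.GeneralizedHardyLittlewood.Cruxes.AbsoluteUpgrade.NlcCellsAbsoluteClip

end
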